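import Literature.NumberTheory.Automorphic.UnitaryGroupIsotropicVectorBoundedHeight
import Literature.NumberTheory.Automorphic.UnitaryGroupKernelDictionary
import HarnessLib

/-!
# The Mahler region of `U(J_N)(𝔸_F)`: it is compact modulo `U(J_N)(F)`, all its rational
# translates have height `≤ 1/λ₁`, and there Arthur's truncated kernel is the untruncated `K(g, g)`

Topic `NumberTheory/Automorphic`; namespace `Literature.NumberTheory.Automorphic.UnitaryGroup`.
Proof file: theorems only (no definition, no named fact, no instance, no `sorry`); imports = tree.
Setting as in `UnitaryGroupIsotropicVectorBoundedHeight`: `g ∈ U(J_N)(𝔸_F)` (`quasiSplit F E c N`),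
`M = adelicVal g ∈ GL_N(𝔸_E)`, `h(ξ g) = vecHeight E (principalVec E ξ ᵥ* M)` for `ξ ∈ E^N`; the MAHLER
REGION of level `ε` is `{g : h(ξ g) ≥ ε for all ξ ∈ E^N ∖ 0}` — all rational vectors are long. It is
left `U(J_N)(F)`-invariant (`ξ γ` runs over `E^N ∖ 0` with `ξ`).

* §1 Gram matrices over a ring: `gram_apply_eq_sum` (`(A J ᵗ(σA))_{ij} = Σ_k A_{ik} σ(A_{j,rev k})`),
  `gram_mul_left` (`G(AP) = A G(P) ᵗ(σA)`), `gram_map` (`G` commutes with base change),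
  `mem_unitaryGroupOfForm_of_gram_eq_over` (`P J ᵗ(σP) = J ⇒ P ∈ U(σ, J)`: the ROW form of unitarity
  implies the defining COLUMN form, `J² = 1`).
* §2 **`exists_isCompact_forall_exists_toAdelic_mul_mem`** — MAHLER'S CRITERION MODULO `U(J_N)(F)`:
  for `ε > 0` there is a COMPACT `K_ε ⊆ U(J_N)(𝔸_F)` such that every `g` in the Mahler region of
  level `ε` has a rational translate `γ g ∈ K_ε`, `γ ∈ U(J_N)(F)`. (★ Mahler
  `exists_isCompact_forall_exists_eq_mul`: `g = γ₀ m₀`, `γ₀ ∈ GL_N(E)`, `m₀ ∈ C`; the Gram matrix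
  `G(m₀) = G(γ₀⁻¹)` is principal in the compact `G(C)`, so takes FINITELY many values (★
  `Godement.finite_inter_principalMatrices`); two rational matrices `γ₀⁻¹, γ₁⁻¹` with the same Gram
  matrix differ by `δ = γ₁ γ₀⁻¹ ∈ U(J_N)(E)` (§1), and `δ g = γ₁ m₀ ∈ γ₁ C` with `γ₁` one of finitely
  many witnesses — the argument of ★ `GodementCompactness.compactSpace_adelicUnitaryQuot` without
  anisotropy.)
* §3 **`borelHeight_mul_le_inv_of_forall_le`** — on the Mahler region `H(γ g) ≤ ε⁻¹` for EVERY
  `γ ∈ U(J_N)(F)` (`H(γ g) = h(e_N γ · g)⁻¹`, `e_N γ ≠ 0`); hence for `T ≥ ε⁻¹` NO translate is above the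
  cut-off and **`k^T(g) = K(g, g)`** (`truncatedKernel_eq_kernel_of_forall_le_inv`, ★
  `truncatedKernel_eq_kernel_of_forall_le`); and **`|K(g, g)| ≤ C_ε`** on the region
  (`exists_forall_norm_kernel_le`: `K(γ g, γ g) = K(g, g)` ★ `kernel_diag_rational_mul`, continuity ★
  `continuous_kernel`, compactness §2) — the LOW part of the integrability of `k^T`
  (Shokranian (1992), Example (5.2): «for `x` in a fixed compact set and `T` large, `k^T(x) = K(x,x)`»;
  Rogawski (1990), §2.2 p. 13). The complement `{λ₁ < ε}` (`ε ≤ 1`) is the cusp: there the short vector is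
  isotropic (★ `isotropic_of_vecHeight_vecMul_lt_one`) and a rational translate has `H > ε⁻¹`
  (★ `UnitaryGroupRationalIsotropicLastRow`).

## References

* R. Godement, *Domaines fondamentaux des groupes arithmétiques*, Sém. Bourbaki 257 (1962/63), §3
  [Godement1964].
* S. Shokranian, *The Selberg–Arthur Trace Formula*, LNM 1503 (1992), §5.1, Example (5.2)
  [Shokranian1992].
* J. D. Rogawski, *Automorphic Representations of Unitary Groups in Three Variables* (1990), §2.2
  [Rogawski1990].
-/

set_option autoImplicit false

noncomputable section

open NumberField IsDedekindDomain Matrix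
open scoped NNReal MatrixGroups Pointwise

namespace Literature.NumberTheory.Automorphic

namespace UnitaryGroup

variable {F E : Type} [Field F] [NumberField F] [Field E] [NumberField E] [Algebra F E]
  {c : E ≃ₐ[F] E} {N : ℕ}

/-! ## §1 Gram matrices over a ring -/

omit [NumberField F] [NumberField E] in
/-- Left multiplication by the antidiagonal matrix reverses the rows: `(J X)_{kj} = X_{rev k, j}`.
[cite: Rogawski1990, §1.9 p. 13] -/
theorem antidiagOver_mul_apply {R : Type*} [CommRing R] (X : Matrix (Fin N) (Fin N) R) (k j : Fin N) :
    ((StdForm.antidiagonal N).over R * X) k j = X (Fin.rev k) j := by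
  have h := congrFun (antidiagOver_mulVec (R := R) (fun l => X l j)) k
  rw [Matrix.mulVec, dotProduct] at h
  rw [Matrix.mul_apply]
  exact h

omit [NumberField F] [NumberField E] in
/-- **Entries of the Gram matrix**: `(A J ᵗ(σA))_{ij} = Σ_k A_{ik} σ(A_{j, rev k})` (any commutative ring,
any `σ`). [cite: Godement1964, §1.1] -/
theorem gram_apply_eq_sum {R : Type*} [CommRing R] (σ : R →+* R) (A : Matrix (Fin N) (Fin N) R)
    (i j : Fin N) :
    (A * (StdForm.antidiagonal N).over R * (A.map σ)ᵀ) i j = ∑ k, A i k * σ (A j (Fin.rev k)) := by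
  rw [Matrix.mul_assoc, Matrix.mul_apply]
  refine Finset.sum_congr rfl fun k _ => ?_
  rw [antidiagOver_mul_apply, Matrix.transpose_apply, Matrix.map_apply]

omit [NumberField F] [NumberField E] in
/-- `G(A P) = A · G(P) · ᵗ(σA)`. [cite: Godement1964, §1.1] -/
theorem gram_mul_left {R : Type*} [CommRing R] (σ : R →+* R) (A P : Matrix (Fin N) (Fin N) R) :
    A * P * (StdForm.antidiagonal N).over R * ((A * P).map σ)ᵀ =
      A * (P * (StdForm.antidiagonal N).over R * (P.map σ)ᵀ) * (A.map σ)ᵀ := by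
  rw [Matrix.map_mul, Matrix.transpose_mul]
  simp only [Matrix.mul_assoc]

omit [NumberField F] [NumberField E] in
/-- **The Gram matrix commutes with base change**: for `f : R → S` intertwining `σ` and `τ`,
`G_τ(f P) = f(G_σ(P))`. [cite: Godement1964, §1.1] -/
theorem gram_map {R S : Type*} [CommRing R] [CommRing S] (f : R →+* S) {σ : R →+* R} {τ : S →+* S}
    (hf : ∀ x, f (σ x) = τ (f x)) (P : Matrix (Fin N) (Fin N) R) :
    P.map f * (StdForm.antidiagonal N).over S * ((P.map f).map τ)ᵀ =
      (P * (StdForm.antidiagonal N).over R * (P.map σ)ᵀ).map f := by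
  ext i j
  rw [gram_apply_eq_sum, Matrix.map_apply, gram_apply_eq_sum, map_sum]
  refine Finset.sum_congr rfl fun k _ => ?_
  rw [map_mul, Matrix.map_apply, Matrix.map_apply, hf]

omit [NumberField F] [NumberField E] in
/-- **Row unitarity implies unitarity**: if `P J ᵗ(σP) = J` then `ᵗ(σP) J P = J`, i.e. `P ∈ U(σ, J)`
(`J² = 1`: `ᵗ(σP) = J P⁻¹ J`). [cite: Rogawski1990, §1.9 p. 13] -/
theorem mem_unitaryGroupOfForm_of_gram_eq_over {R : Type*} [CommRing R] (σ : R →+* R) (P : GL (Fin N) R)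
    (h : (P : Matrix (Fin N) (Fin N) R) * (StdForm.antidiagonal N).over R *
      ((P : Matrix (Fin N) (Fin N) R).map σ)ᵀ = (StdForm.antidiagonal N).over R) :
    P ∈ unitaryGroupOfForm σ ((StdForm.antidiagonal N).over R) := by
  set J : Matrix (Fin N) (Fin N) R := (StdForm.antidiagonal N).over R with hJ
  set A : Matrix (Fin N) (Fin N) R := (P : Matrix (Fin N) (Fin N) R) with hA
  set Q : Matrix (Fin N) (Fin N) R := ((P : Matrix (Fin N) (Fin N) R).map σ)ᵀ with hQ
  have hJJ : J * J = 1 := by rw [hJ, StdForm.over_mul_over]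
  have hPinv : ((P⁻¹ : GL (Fin N) R) : Matrix (Fin N) (Fin N) R) * A = 1 := by
    rw [hA, ← Units.val_mul, inv_mul_cancel, Units.val_one]
  -- `J Q = P⁻¹ J`
  have h1 : J * Q = ((P⁻¹ : GL (Fin N) R) : Matrix (Fin N) (Fin N) R) * J := by
    calc J * Q = (((P⁻¹ : GL (Fin N) R) : Matrix (Fin N) (Fin N) R) * A) * (J * Q) := by
          rw [hPinv, Matrix.one_mul]
      _ = ((P⁻¹ : GL (Fin N) R) : Matrix (Fin N) (Fin N) R) * (A * J * Q) := by
          simp only [Matrix.mul_assoc]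
      _ = ((P⁻¹ : GL (Fin N) R) : Matrix (Fin N) (Fin N) R) * J := by rw [h]
  -- `Q = J P⁻¹ J`
  have h2 : Q = J * ((P⁻¹ : GL (Fin N) R) : Matrix (Fin N) (Fin N) R) * J := by
    calc Q = (J * J) * Q := by rw [hJJ, Matrix.one_mul]
      _ = J * (J * Q) := by rw [Matrix.mul_assoc]
      _ = J * ((P⁻¹ : GL (Fin N) R) : Matrix (Fin N) (Fin N) R) * J := by rw [h1, Matrix.mul_assoc]
  rw [mem_unitaryGroupOfForm_iff]
  change Q * J * A = J
  rw [h2]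
  calc J * ((P⁻¹ : GL (Fin N) R) : Matrix (Fin N) (Fin N) R) * J * J * A
      = J * ((P⁻¹ : GL (Fin N) R) : Matrix (Fin N) (Fin N) R) * (J * J) * A := by
        simp only [Matrix.mul_assoc]
    _ = J := by rw [hJJ, Matrix.mul_one, Matrix.mul_assoc, hPinv, Matrix.mul_one]

/-! ## §2 Mahler's criterion modulo `U(J_N)(F)` -/

/-- **MAHLER'S CRITERION MODULO `U(J_N)(F)`.** For `ε > 0` there is a compact
`K_ε ⊆ U(J_N)(𝔸_F)` such that every `g` all of whose rational vectors have height `h(ξ g) ≥ ε` has a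
rational translate `γ g ∈ K_ε`, `γ ∈ U(J_N)(F)`. [cite: Godement1964, §3, Thm. 3 and §4] -/
theorem exists_isCompact_forall_exists_toAdelic_mul_mem {ε : ℝ≥0} (hε : 0 < ε) :
    ∃ Kc : Set (quasiSplit F E c N).Adelic, IsCompact Kc ∧ ∀ g : (quasiSplit F E c N).Adelic,
      (∀ ξ : Fin N → E, ξ ≠ 0 →
        ε ≤ vecHeight E (principalVec E ξ ᵥ* (adelicVal F E c N _ g : Matrix (Fin N) (Fin N) (AdeleRing (𝓞 E) E)))) →
      ∃ γ : (quasiSplit F E c N).Rational, (quasiSplit F E c N).toAdelic γ * g ∈ Kc := by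
  classical
  -- Mahler in `GL_N(𝔸_E)`
  obtain ⟨C, hC, hMah⟩ := Mahler.exists_isCompact_rational_mul N E ε 1 hε
  -- the Gram map and the finitely many principal Gram matrices over `C`
  set G : GL (Fin N) (AdeleRing (𝓞 E) E) → Matrix (Fin N) (Fin N) (AdeleRing (𝓞 E) E) := fun m =>
    (m : Matrix (Fin N) (Fin N) (AdeleRing (𝓞 E) E)) * (StdForm.antidiagonal N).over (AdeleRing (𝓞 E) E) *
      ((m : Matrix (Fin N) (Fin N) (AdeleRing (𝓞 E) E)).map (conjAdele F E c))ᵀ with hG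
  have hGc : Continuous G := continuous_gram
  have hfin : (G '' C ∩ Godement.principalMatrices E).Finite :=
    Godement.finite_inter_principalMatrices E (hC.image hGc)
  -- one rational witness per Gram class
  let γw : Matrix (Fin N) (Fin N) (AdeleRing (𝓞 E) E) → GL (Fin N) E := fun Γ =>
    if h : ∃ γ : GL (Fin N) E, ∃ g' : (quasiSplit F E c N).Adelic, ∃ m' ∈ C,
        adelicVal F E c N _ g' = Matrix.GeneralLinearGroup.map (algebraMap E (AdeleRing (𝓞 E) E)) γ * m' ∧
          G m' = Γ then h.choose else 1
  -- the compact set: preimage of the finitely many translates `γw(Γ) • C`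
  set KC : Set (GL (Fin N) (AdeleRing (𝓞 E) E)) :=
    ⋃ Γ ∈ hfin.toFinset, (Matrix.GeneralLinearGroup.map (algebraMap E (AdeleRing (𝓞 E) E)) (γw Γ)) • C with hKC
  have hKCc : IsCompact KC := hfin.toFinset.isCompact_biUnion fun Γ _ => hC.smul _
  have hcl : IsClosed ((adelic F E c N ((StdForm.antidiagonal N).over E) :
      Subgroup (GL (Fin N) (AdeleRing (𝓞 E) E))) : Set (GL (Fin N) (AdeleRing (𝓞 E) E))) :=
    isClosed_unitaryGroupOfForm_conjAdele F E c _
  have hKc' : IsCompact ((Subtype.val : ↥(adelic F E c N ((StdForm.antidiagonal N).over E)) →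
      GL (Fin N) (AdeleRing (𝓞 E) E)) ⁻¹' KC) :=
    hcl.isClosedEmbedding_subtypeVal.isCompact_preimage hKCc
  refine ⟨{x : (quasiSplit F E c N).Adelic | adelicVal F E c N _ x ∈ KC}, hKc', fun g hg => ?_⟩
  set M : GL (Fin N) (AdeleRing (𝓞 E) E) := adelicVal F E c N _ g with hM
  obtain ⟨x, ⟨γ₀, rfl⟩, m₀, hm₀, hx⟩ := Set.mem_mul.1 (hMah M hg (le_of_eq (ideleNorm_det_adelicVal g)))
  have hγm : M = Matrix.GeneralLinearGroup.map (algebraMap E (AdeleRing (𝓞 E) E)) γ₀ * m₀ := hx.symm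
  have hm₀GL : (Matrix.GeneralLinearGroup.map (algebraMap E (AdeleRing (𝓞 E) E)) γ₀)⁻¹ * M = m₀ :=
    inv_mul_eq_of_eq_mul hγm
  -- `G(m₀) = (G_E(γ₀⁻¹))_𝔸`
  have hGm₀ : G m₀ = (((γ₀⁻¹ : GL (Fin N) E) : Matrix (Fin N) (Fin N) E) * (StdForm.antidiagonal N).over E *
      (((γ₀⁻¹ : GL (Fin N) E) : Matrix (Fin N) (Fin N) E).map (c : E →+* E))ᵀ).map
        (algebraMap E (AdeleRing (𝓞 E) E)) := by
    have hm₀eq : (m₀ : Matrix (Fin N) (Fin N) (AdeleRing (𝓞 E) E)) =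
        ((γ₀⁻¹ : GL (Fin N) E) : Matrix (Fin N) (Fin N) E).map (algebraMap E (AdeleRing (𝓞 E) E)) *
          (M : Matrix (Fin N) (Fin N) (AdeleRing (𝓞 E) E)) := by
      rw [← hm₀GL, ← map_inv, Units.val_mul]
      rfl
    show (m₀ : Matrix (Fin N) (Fin N) (AdeleRing (𝓞 E) E)) * (StdForm.antidiagonal N).over (AdeleRing (𝓞 E) E) *
        ((m₀ : Matrix (Fin N) (Fin N) (AdeleRing (𝓞 E) E)).map (conjAdele F E c))ᵀ = _
    rw [hm₀eq, gram_mul_adelicVal, gram_map (algebraMap E (AdeleRing (𝓞 E) E)) (σ := (c : E →+* E))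
      (τ := conjAdele F E c) (fun x => algebraMap_conj F E c x)]
  -- the Gram class is one of the finitely many
  have hΓP : G m₀ ∈ Godement.principalMatrices E := by
    rw [hGm₀]; intro i j; exact ⟨_, rfl⟩
  have hΓ : G m₀ ∈ hfin.toFinset := hfin.mem_toFinset.2 ⟨⟨m₀, hm₀, rfl⟩, hΓP⟩
  have hW : ∃ γ : GL (Fin N) E, ∃ g' : (quasiSplit F E c N).Adelic, ∃ m' ∈ C,
      adelicVal F E c N _ g' = Matrix.GeneralLinearGroup.map (algebraMap E (AdeleRing (𝓞 E) E)) γ * m' ∧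
        G m' = G m₀ :=
    ⟨γ₀, g, m₀, hm₀, hγm, rfl⟩
  have hγw : γw (G m₀) = hW.choose := dif_pos hW
  obtain ⟨g₁, m₁, hm₁, hg₁eq, hGm₁⟩ := hW.choose_spec
  set γ₁ : GL (Fin N) E := hW.choose with hγ₁
  -- `G(m₁) = (G_E(γ₁⁻¹))_𝔸`, hence `G_E(γ₁⁻¹) = G_E(γ₀⁻¹)`
  have hGm₁' : G m₁ = (((γ₁⁻¹ : GL (Fin N) E) : Matrix (Fin N) (Fin N) E) * (StdForm.antidiagonal N).over E *
      (((γ₁⁻¹ : GL (Fin N) E) : Matrix (Fin N) (Fin N) E).map (c : E →+* E))ᵀ).map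
        (algebraMap E (AdeleRing (𝓞 E) E)) := by
    have hm₁GL : (Matrix.GeneralLinearGroup.map (algebraMap E (AdeleRing (𝓞 E) E)) γ₁)⁻¹ *
        adelicVal F E c N _ g₁ = m₁ := inv_mul_eq_of_eq_mul hg₁eq
    have hm₁eq : (m₁ : Matrix (Fin N) (Fin N) (AdeleRing (𝓞 E) E)) =
        ((γ₁⁻¹ : GL (Fin N) E) : Matrix (Fin N) (Fin N) E).map (algebraMap E (AdeleRing (𝓞 E) E)) *
          (adelicVal F E c N _ g₁ : Matrix (Fin N) (Fin N) (AdeleRing (𝓞 E) E)) := by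
      rw [← hm₁GL, ← map_inv, Units.val_mul]
      rfl
    show (m₁ : Matrix (Fin N) (Fin N) (AdeleRing (𝓞 E) E)) * (StdForm.antidiagonal N).over (AdeleRing (𝓞 E) E) *
        ((m₁ : Matrix (Fin N) (Fin N) (AdeleRing (𝓞 E) E)).map (conjAdele F E c))ᵀ = _
    rw [hm₁eq, gram_mul_adelicVal, gram_map (algebraMap E (AdeleRing (𝓞 E) E)) (σ := (c : E →+* E))
      (τ := conjAdele F E c) (fun x => algebraMap_conj F E c x)]
  have hGE : ((γ₁⁻¹ : GL (Fin N) E) : Matrix (Fin N) (Fin N) E) * (StdForm.antidiagonal N).over E *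
      (((γ₁⁻¹ : GL (Fin N) E) : Matrix (Fin N) (Fin N) E).map (c : E →+* E))ᵀ =
      ((γ₀⁻¹ : GL (Fin N) E) : Matrix (Fin N) (Fin N) E) * (StdForm.antidiagonal N).over E *
      (((γ₀⁻¹ : GL (Fin N) E) : Matrix (Fin N) (Fin N) E).map (c : E →+* E))ᵀ := by
    haveI : Nontrivial (AdeleRing (𝓞 E) E) :=
      inferInstanceAs (Nontrivial (InfiniteAdeleRing E × FiniteAdeleRing (𝓞 E) E))
    have hinj : Function.Injective fun P : Matrix (Fin N) (Fin N) E =>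
        P.map (algebraMap E (AdeleRing (𝓞 E) E)) :=
      fun P Q hPQ => Matrix.map_injective (algebraMap E (AdeleRing (𝓞 E) E)).injective hPQ
    apply hinj
    simp only
    rw [← hGm₁', ← hGm₀, hGm₁]
  -- `δ = γ₁ γ₀⁻¹` is unitary over `E`
  set δ : GL (Fin N) E := γ₁ * γ₀⁻¹ with hδ
  have hδU : δ ∈ unitaryGroupOfForm (c : E →+* E) ((StdForm.antidiagonal N).over E) := by
    apply mem_unitaryGroupOfForm_of_gram_eq_over
    rw [hδ, Units.val_mul, gram_mul_left, ← hGE, ← gram_mul_left, ← Units.val_mul, mul_inv_cancel,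
      Units.val_one, Matrix.one_mul, Matrix.map_one (c : E →+* E) (map_zero _) (map_one _),
      Matrix.transpose_one, Matrix.mul_one]
  refine ⟨⟨δ, hδU⟩, ?_⟩
  -- `δ g = γ₁ m₀ ∈ γ₁ • C`
  show adelicVal F E c N _ ((quasiSplit F E c N).toAdelic ⟨δ, hδU⟩ * g) ∈ KC
  have hval : adelicVal F E c N _ ((quasiSplit F E c N).toAdelic ⟨δ, hδU⟩ * g) =
      Matrix.GeneralLinearGroup.map (algebraMap E (AdeleRing (𝓞 E) E)) γ₁ * m₀ := by
    rw [map_mul, ← hM]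
    change Matrix.GeneralLinearGroup.map (algebraMap E (AdeleRing (𝓞 E) E)) δ * M = _
    rw [hδ, map_mul, map_inv, mul_assoc, hm₀GL]
  rw [hval, hKC]
  refine Set.mem_biUnion hΓ ?_
  rw [hγw]
  exact Set.smul_mem_smul_set hm₀

/-! ## §3 Heights and the truncated kernel on the Mahler region -/

/-- **On the Mahler region all rational translates have height `≤ ε⁻¹`**: `H(γ g) = h(e_N γ · g)⁻¹` and
`e_N γ ≠ 0`. [cite: Godement1964, §3] -/
theorem borelHeight_mul_le_inv_of_forall_le [NeZero N] {ε : ℝ≥0} (hε : 0 < ε) {g : (quasiSplit F E c N).Adelic}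
    (hg : ∀ ξ : Fin N → E, ξ ≠ 0 →
      ε ≤ vecHeight E (principalVec E ξ ᵥ* (adelicVal F E c N _ g : Matrix (Fin N) (Fin N) (AdeleRing (𝓞 E) E))))
    (γ : (quasiSplit F E c N).arithmeticSubgroup) :
    borelHeight ((γ : (quasiSplit F E c N).Adelic) * g) ≤ ε⁻¹ := by
  obtain ⟨γ₀, hγ₀⟩ := MonoidHom.mem_range.mp γ.2
  rw [← hγ₀, borelHeight_def, lastRow_mul, lastRow_toAdelic]
  exact inv_anti₀ hε (hg _ (lastRow_rational_ne_zero γ₀))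

/-- **`k^T = K` on the Mahler region** for `T ≥ ε⁻¹`: no rational translate is above the cut-off, so the
correction term of Arthur's truncated kernel vanishes (Shokranian (1992), Example (5.2)).
[cite: Shokranian1992, §5.1 Example (5.2)] -/
theorem truncatedKernel_eq_kernel_of_forall_le_vecHeight [NeZero N] [MeasurableSpace (adelicUnipotent F E c N)]
    {ν : MeasureTheory.Measure (adelicUnipotent F E c N)} {𝓕 : Set (adelicUnipotent F E c N)} {T ε : ℝ≥0}
    (hε : 0 < ε) (hT : ε⁻¹ ≤ T) (f : (quasiSplit F E c N).Adelic → ℂ) {g : (quasiSplit F E c N).Adelic}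
    (hg : ∀ ξ : Fin N → E, ξ ≠ 0 →
      ε ≤ vecHeight E (principalVec E ξ ᵥ* (adelicVal F E c N _ g : Matrix (Fin N) (Fin N) (AdeleRing (𝓞 E) E)))) :
    truncatedKernel ν 𝓕 T f g = kernel f g g :=
  truncatedKernel_eq_kernel_of_forall_le f fun γ => (borelHeight_mul_le_inv_of_forall_le hε hg γ).trans hT

/-- **`K(g, g)` is bounded on the Mahler region**: `K(γ g, γ g) = K(g, g)` (★ `kernel_diag_rational_mul`),
`γ g` ranges in the compact `K_ε` (§2) and `K` is continuous for `f ∈ C_c` (★ `continuous_kernel`).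
[cite: Rogawski1990, §2.2 (p. 13)] -/
theorem exists_forall_norm_kernel_le {ε : ℝ≥0} (hε : 0 < ε) {f : (quasiSplit F E c N).Adelic → ℂ}
    (hfc : Continuous f) (hf : HasCompactSupport f) :
    ∃ Cb : ℝ, ∀ g : (quasiSplit F E c N).Adelic,
      (∀ ξ : Fin N → E, ξ ≠ 0 →
        ε ≤ vecHeight E (principalVec E ξ ᵥ* (adelicVal F E c N _ g : Matrix (Fin N) (Fin N) (AdeleRing (𝓞 E) E)))) →
      ‖kernel f g g‖ ≤ Cb := by
  obtain ⟨Kc, hKc, hmem⟩ := exists_isCompact_forall_exists_toAdelic_mul_mem (F := F) (E := E) (c := c) (N := N) hε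
  have hcont : Continuous fun x : (quasiSplit F E c N).Adelic => kernel f x x := by
    letI : MeasurableSpace (quasiSplit F E c N).Adelic := borel _
    haveI : BorelSpace (quasiSplit F E c N).Adelic := ⟨rfl⟩
    have h1 : Continuous fun x : (quasiSplit F E c N).Adelic => (x, x) := continuous_id.prodMk continuous_id
    have hF : Continuous ((fun p : (quasiSplit F E c N).Adelic × (quasiSplit F E c N).Adelic => kernel f p.1 p.2) ∘
        fun x : (quasiSplit F E c N).Adelic => (x, x)) :=
      Continuous.comp (continuous_kernel hfc hf) h1
    exact hF
  obtain ⟨Cb, hCb⟩ := hKc.exists_bound_of_continuousOn hcont.continuousOn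
  refine ⟨Cb, fun g hg => ?_⟩
  obtain ⟨γ, hγ⟩ := hmem g hg
  rw [← kernel_diag_rational_mul f ⟨(quasiSplit F E c N).toAdelic γ, ⟨γ, rfl⟩⟩ g]
  exact hCb _ hγ

/-- **THE LOW PART OF THE TRUNCATED KERNEL**: for `T ≥ ε⁻¹`, on the Mahler region of level `ε` one has
`‖k^T(g)‖ ≤ C_ε(f)`, uniformly in `ν, 𝓕, T`. [cite: Shokranian1992, §5.1 Example (5.2)] -/
theorem exists_forall_norm_truncatedKernel_le [NeZero N] [MeasurableSpace (adelicUnipotent F E c N)]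
    {ε : ℝ≥0} (hε : 0 < ε) {f : (quasiSplit F E c N).Adelic → ℂ} (hfc : Continuous f)
    (hf : HasCompactSupport f) :
    ∃ Cb : ℝ, ∀ (ν : MeasureTheory.Measure (adelicUnipotent F E c N)) (𝓕 : Set (adelicUnipotent F E c N))
      (T : ℝ≥0), ε⁻¹ ≤ T → ∀ g : (quasiSplit F E c N).Adelic,
      (∀ ξ : Fin N → E, ξ ≠ 0 →
        ε ≤ vecHeight E (principalVec E ξ ᵥ* (adelicVal F E c N _ g : Matrix (Fin N) (Fin N) (AdeleRing (𝓞 E) E)))) →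
      ‖truncatedKernel ν 𝓕 T f g‖ ≤ Cb := by
  obtain ⟨Cb, hCb⟩ := exists_forall_norm_kernel_le (F := F) (E := E) (c := c) (N := N) hε hfc hf
  exact ⟨Cb, fun ν 𝓕 T hT g hg => by
    rw [truncatedKernel_eq_kernel_of_forall_le_vecHeight hε hT f hg]; exact hCb g hg⟩

end UnitaryGroup

end Literature.NumberTheory.Automorphic
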